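import Summits.ValiantsHypothesis.ValiantsHypothesis.Theorems.FreeSubtorusOrbitDimensionBoundStubStableReductionSplit

/-!
# `OrbitDimensionBound` (stmt-ValiantsHypothesis-16133), rung line `filtered_covering` — stub `stub_polystableModel`,
# part 4: block-diagonal sums — atoms and stacked weights

Helper file (part 4) for stub 1 `stub_polystableModel` of `Cruxes/OrbitDimensionBound/Lines/filtered_covering.lean`
(route `FreeSubtorus`).  Two bookkeeping lemmas for the recursion that degenerates an arbitrary square pencil to a
semisimple one along block-triangular splits (part 5):

* **`exists_atoms_of_blockDiag`** — if the tops of the balanced lattices of `N₁` (`d × d`) and `N₂` (`(m-d) × (m-d)`) are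
  finite joins of atoms, so is the top for the block-diagonal sum `N` (`N = e (N₁ ⊕ N₂) e⁻¹` along the tree's
  `cornerEquiv`): the atoms of the summands, extended by zero, are atoms of `N` and together span `ℂ^m`;
* **`truncate_stack`** — STACKING one-parameter degenerations: for a block upper triangular `Y` (zero corner) whose
  diagonal blocks carry weights `(a₁, b₁)`, `(a₂, b₂)` satisfying the vanishing conditions, the weights
  `(a₁ + K, b₁ + K) ⊔ (a₂, b₂)` with `K` large satisfy the vanishing condition for `Y`, have equal sums, and truncate `Y`
  to the block-diagonal sum of the truncations of the blocks.

Helper mode (`--supports stmt-ValiantsHypothesis-16133 --as helper`).  Honest framing: [folklore] linear algebra toward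
ONE registered stub (`stub_polystableModel`, L) of a dormant rung line; the crux `OrbitDimensionBound`, the route
`FreeSubtorus` and VP ≠ VNP are OPEN and are not moved by this file.
-/

set_option linter.dupNamespace false

namespace Summit.ValiantsHypothesis.ValiantsHypothesis.Theorems.FreeSubtorusOrbitDimensionBound.SquareCovering.StableReduction

open Matrix MvPolynomial Module
open Literature.Computability.AlgebraicComplexity

/-! ### §1 Stacked weights -/

section Stack

variable {R : Type*} [CommRing R] {m d : ℕ}

/-- **Stacking one-parameter degenerations along a block-triangular split** (see the module docstring). [folklore] -/
theorem truncate_stack (hdm : d ≤ m) (Y : Matrix (Fin m) (Fin m) R)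
    (hY : ∀ i j : Fin m, d ≤ (i : ℕ) → (j : ℕ) < d → Y i j = 0)
    (a₁ b₁ : Fin d → ℕ) (a₂ b₂ : Fin (m - d) → ℕ)
    (hs₁ : ∑ i, a₁ i = ∑ j, b₁ j) (hs₂ : ∑ i, a₂ i = ∑ j, b₂ j)
    (hz₁ : ∀ i j, a₁ i < b₁ j → Y (cornerEquiv d m hdm (Sum.inl i)) (cornerEquiv d m hdm (Sum.inl j)) = 0)
    (hz₂ : ∀ i j, a₂ i < b₂ j → Y (cornerEquiv d m hdm (Sum.inr i)) (cornerEquiv d m hdm (Sum.inr j)) = 0)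
    (K : ℕ) (hKa : ∀ i, a₂ i < K) (hKb : ∀ j, b₂ j < K) :
    ∑ k, Sum.elim (fun i => a₁ i + K) a₂ ((cornerEquiv d m hdm).symm k) =
        ∑ k, Sum.elim (fun j => b₁ j + K) b₂ ((cornerEquiv d m hdm).symm k) ∧
      (∀ k l : Fin m, Sum.elim (fun i => a₁ i + K) a₂ ((cornerEquiv d m hdm).symm k) <
        Sum.elim (fun j => b₁ j + K) b₂ ((cornerEquiv d m hdm).symm l) → Y k l = 0) ∧
      (Matrix.of fun k l => if Sum.elim (fun i => a₁ i + K) a₂ ((cornerEquiv d m hdm).symm k) =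
          Sum.elim (fun j => b₁ j + K) b₂ ((cornerEquiv d m hdm).symm l) then Y k l else 0) =
        Matrix.reindex (cornerEquiv d m hdm) (cornerEquiv d m hdm) (Matrix.fromBlocks
          (Matrix.of fun i j => if a₁ i = b₁ j then Y (cornerEquiv d m hdm (Sum.inl i)) (cornerEquiv d m hdm (Sum.inl j)) else 0)
          0 0
          (Matrix.of fun i j => if a₂ i = b₂ j then Y (cornerEquiv d m hdm (Sum.inr i)) (cornerEquiv d m hdm (Sum.inr j)) else 0)) := by
  set e := cornerEquiv d m hdm with he
  refine ⟨?_, ?_, ?_⟩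
  · rw [← e.sum_comp, ← e.sum_comp]
    simp only [Equiv.symm_apply_apply, Fintype.sum_sum_type, Sum.elim_inl, Sum.elim_inr, Finset.sum_add_distrib, hs₁, hs₂]
  · intro k l hkl
    obtain ⟨x, rfl⟩ := e.surjective k
    obtain ⟨y, rfl⟩ := e.surjective l
    rw [Equiv.symm_apply_apply, Equiv.symm_apply_apply] at hkl
    rcases x with i | i <;> rcases y with j | j
    · simp only [Sum.elim_inl] at hkl
      exact hz₁ i j (by omega)
    · simp only [Sum.elim_inl, Sum.elim_inr] at hkl
      have := hKb j; omega
    · exact hY _ _ (by rw [he, cornerEquiv_inr_val]; omega) (by rw [he, cornerEquiv_inl_val]; exact j.2)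
    · simp only [Sum.elim_inr] at hkl
      exact hz₂ i j hkl
  · ext k l
    obtain ⟨x, rfl⟩ := e.surjective k
    obtain ⟨y, rfl⟩ := e.surjective l
    simp only [Matrix.of_apply, Matrix.reindex_apply, Matrix.submatrix_apply, Equiv.symm_apply_apply]
    rcases x with i | i <;> rcases y with j | j
    · simp only [Sum.elim_inl, Matrix.fromBlocks_apply₁₁, Matrix.of_apply, add_left_inj]
    · simp only [Sum.elim_inl, Sum.elim_inr, Matrix.fromBlocks_apply₁₂, Matrix.zero_apply]
      rw [if_neg]; have := hKb j; omega
    · simp only [Sum.elim_inl, Sum.elim_inr, Matrix.fromBlocks_apply₂₁, Matrix.zero_apply]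
      rw [if_neg]; have := hKa i; omega
    · simp only [Sum.elim_inr, Matrix.fromBlocks_apply₂₂, Matrix.of_apply]
      rfl

end Stack

/-! ### §2 Atoms of a block-diagonal sum -/

section Atoms

variable {σ : Type*} {m d : ℕ}

/-- **Atoms of a block-diagonal sum** (see the module docstring). [folklore] -/
theorem exists_atoms_of_blockDiag (hdm : d ≤ m) (N₁ : Matrix (Fin d) (Fin d) (MvPolynomial σ ℂ))
    (N₂ : Matrix (Fin (m - d)) (Fin (m - d)) (MvPolynomial σ ℂ))
    (T₁ : Finset (Submodule ℂ (Fin d → ℂ)))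
    (hT₁ : ∀ A ∈ T₁, A ≠ ⊥ ∧ finrank ℂ ↥(⨆ e : σ →₀ ℕ, A.map (Matrix.toLin' (N₁.map (coeff e)))) ≤ finrank ℂ A ∧
      ∀ A' : Submodule ℂ (Fin d → ℂ), A' ≤ A → A' ≠ ⊥ →
        finrank ℂ ↥(⨆ e : σ →₀ ℕ, A'.map (Matrix.toLin' (N₁.map (coeff e)))) ≤ finrank ℂ A' → A' = A)
    (hT₁top : T₁.sup id = ⊤)
    (T₂ : Finset (Submodule ℂ (Fin (m - d) → ℂ)))
    (hT₂ : ∀ A ∈ T₂, A ≠ ⊥ ∧ finrank ℂ ↥(⨆ e : σ →₀ ℕ, A.map (Matrix.toLin' (N₂.map (coeff e)))) ≤ finrank ℂ A ∧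
      ∀ A' : Submodule ℂ (Fin (m - d) → ℂ), A' ≤ A → A' ≠ ⊥ →
        finrank ℂ ↥(⨆ e : σ →₀ ℕ, A'.map (Matrix.toLin' (N₂.map (coeff e)))) ≤ finrank ℂ A' → A' = A)
    (hT₂top : T₂.sup id = ⊤) :
    ∃ T : Finset (Submodule ℂ (Fin m → ℂ)),
      (∀ A ∈ T, A ≠ ⊥ ∧
        finrank ℂ ↥(⨆ e : σ →₀ ℕ, A.map (Matrix.toLin' ((Matrix.reindex (cornerEquiv d m hdm) (cornerEquiv d m hdm)
          (Matrix.fromBlocks N₁ 0 0 N₂)).map (coeff e)))) ≤ finrank ℂ A ∧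
        ∀ A' : Submodule ℂ (Fin m → ℂ), A' ≤ A → A' ≠ ⊥ →
          finrank ℂ ↥(⨆ e : σ →₀ ℕ, A'.map (Matrix.toLin' ((Matrix.reindex (cornerEquiv d m hdm) (cornerEquiv d m hdm)
            (Matrix.fromBlocks N₁ 0 0 N₂)).map (coeff e)))) ≤ finrank ℂ A' → A' = A) ∧
      T.sup id = ⊤ := by
  classical
  set e := cornerEquiv d m hdm with he
  set N := Matrix.reindex e e (Matrix.fromBlocks N₁ 0 0 N₂) with hN
  -- the two embeddings (extension by zero) and the two restrictions
  let ι₁ : (Fin d → ℂ) →ₗ[ℂ] (Fin m → ℂ) :=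
    { toFun := fun v k => Sum.elim v 0 (e.symm k)
      map_add' := fun v v' => funext fun k => by rcases hk : e.symm k with i | i <;> simp [hk]
      map_smul' := fun c v => funext fun k => by rcases hk : e.symm k with i | i <;> simp [hk] }
  let ι₂ : (Fin (m - d) → ℂ) →ₗ[ℂ] (Fin m → ℂ) :=
    { toFun := fun v k => Sum.elim 0 v (e.symm k)
      map_add' := fun v v' => funext fun k => by rcases hk : e.symm k with i | i <;> simp [hk]
      map_smul' := fun c v => funext fun k => by rcases hk : e.symm k with i | i <;> simp [hk] }
  let ρ₁ : (Fin m → ℂ) →ₗ[ℂ] (Fin d → ℂ) :=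
    { toFun := fun u i => u (e (Sum.inl i)), map_add' := fun _ _ => rfl, map_smul' := fun _ _ => rfl }
  let ρ₂ : (Fin m → ℂ) →ₗ[ℂ] (Fin (m - d) → ℂ) :=
    { toFun := fun u i => u (e (Sum.inr i)), map_add' := fun _ _ => rfl, map_smul' := fun _ _ => rfl }
  have hι₁ : ∀ v i, ι₁ v (e (Sum.inl i)) = v i := fun v i => by
    change Sum.elim v 0 (e.symm (e (Sum.inl i))) = v i; rw [Equiv.symm_apply_apply, Sum.elim_inl]
  have hι₁' : ∀ v i, ι₁ v (e (Sum.inr i)) = 0 := fun v i => by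
    change Sum.elim v (0 : Fin (m - d) → ℂ) (e.symm (e (Sum.inr i))) = 0
    rw [Equiv.symm_apply_apply, Sum.elim_inr]; rfl
  have hι₂ : ∀ v i, ι₂ v (e (Sum.inr i)) = v i := fun v i => by
    change Sum.elim (0 : Fin d → ℂ) v (e.symm (e (Sum.inr i))) = v i; rw [Equiv.symm_apply_apply, Sum.elim_inr]
  have hι₂' : ∀ v i, ι₂ v (e (Sum.inl i)) = 0 := fun v i => by
    change Sum.elim (0 : Fin d → ℂ) v (e.symm (e (Sum.inl i))) = 0
    rw [Equiv.symm_apply_apply, Sum.elim_inl]; rfl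
  have hρι₁ : ∀ v, ρ₁ (ι₁ v) = v := fun v => funext fun i => hι₁ v i
  have hρι₂ : ∀ v, ρ₂ (ι₂ v) = v := fun v => funext fun i => hι₂ v i
  have hι₁inj : Function.Injective ι₁ := Function.LeftInverse.injective hρι₁
  have hι₂inj : Function.Injective ι₂ := Function.LeftInverse.injective hρι₂
  -- the action of the coefficient matrices of `N` on the two blocks
  have hN₁ : ∀ (f : σ →₀ ℕ) (v : Fin d → ℂ),
      Matrix.toLin' (N.map (coeff f)) (ι₁ v) = ι₁ (Matrix.toLin' (N₁.map (coeff f)) v) := by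
    intro f v
    ext k
    obtain ⟨x, rfl⟩ := e.surjective k
    rw [Matrix.toLin'_apply, Matrix.mulVec, dotProduct, ← e.sum_comp, Fintype.sum_sum_type]
    simp only [hN, Matrix.map_apply, Matrix.reindex_apply, Matrix.submatrix_apply, Equiv.symm_apply_apply, hι₁, hι₁',
      mul_zero, Finset.sum_const_zero, add_zero]
    rcases x with i | i
    · rw [hι₁, Matrix.toLin'_apply, Matrix.mulVec, dotProduct]
      simp only [Matrix.fromBlocks_apply₁₁, Matrix.map_apply]
    · rw [hι₁']
      simp only [Matrix.fromBlocks_apply₂₁, Matrix.zero_apply, coeff_zero, zero_mul, Finset.sum_const_zero]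
  have hN₂ : ∀ (f : σ →₀ ℕ) (v : Fin (m - d) → ℂ),
      Matrix.toLin' (N.map (coeff f)) (ι₂ v) = ι₂ (Matrix.toLin' (N₂.map (coeff f)) v) := by
    intro f v
    ext k
    obtain ⟨x, rfl⟩ := e.surjective k
    rw [Matrix.toLin'_apply, Matrix.mulVec, dotProduct, ← e.sum_comp, Fintype.sum_sum_type]
    simp only [hN, Matrix.map_apply, Matrix.reindex_apply, Matrix.submatrix_apply, Equiv.symm_apply_apply, hι₂, hι₂',
      mul_zero, Finset.sum_const_zero, zero_add]
    rcases x with i | i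
    · rw [hι₂']
      simp only [Matrix.fromBlocks_apply₁₂, Matrix.zero_apply, coeff_zero, zero_mul, Finset.sum_const_zero]
    · rw [hι₂, Matrix.toLin'_apply, Matrix.mulVec, dotProduct]
      simp only [Matrix.fromBlocks_apply₂₂, Matrix.map_apply]
  -- `W_N (ι U') = ι (W_{N_k} U')`
  have hW₁ : ∀ U' : Submodule ℂ (Fin d → ℂ), (⨆ f : σ →₀ ℕ, (U'.map ι₁).map (Matrix.toLin' (N.map (coeff f)))) =
      (⨆ f : σ →₀ ℕ, U'.map (Matrix.toLin' (N₁.map (coeff f)))).map ι₁ := by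
    intro U'
    rw [Submodule.map_iSup]
    refine iSup_congr fun f => ?_
    rw [← Submodule.map_comp, ← Submodule.map_comp]
    congr 1
    exact LinearMap.ext fun v => hN₁ f v
  have hW₂ : ∀ U' : Submodule ℂ (Fin (m - d) → ℂ), (⨆ f : σ →₀ ℕ, (U'.map ι₂).map (Matrix.toLin' (N.map (coeff f)))) =
      (⨆ f : σ →₀ ℕ, U'.map (Matrix.toLin' (N₂.map (coeff f)))).map ι₂ := by
    intro U'
    rw [Submodule.map_iSup]
    refine iSup_congr fun f => ?_
    rw [← Submodule.map_comp, ← Submodule.map_comp]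
    congr 1
    exact LinearMap.ext fun v => hN₂ f v
  have hfin₁ : ∀ U' : Submodule ℂ (Fin d → ℂ), finrank ℂ ↥(U'.map ι₁) = finrank ℂ U' := fun U' =>
    LinearEquiv.finrank_eq (Submodule.equivMapOfInjective ι₁ hι₁inj U').symm
  have hfin₂ : ∀ U' : Submodule ℂ (Fin (m - d) → ℂ), finrank ℂ ↥(U'.map ι₂) = finrank ℂ U' := fun U' =>
    LinearEquiv.finrank_eq (Submodule.equivMapOfInjective ι₂ hι₂inj U').symm
  -- atoms transport
  have hat₁ : ∀ A ∈ T₁, (A.map ι₁) ≠ ⊥ ∧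
      finrank ℂ ↥(⨆ f : σ →₀ ℕ, (A.map ι₁).map (Matrix.toLin' (N.map (coeff f)))) ≤ finrank ℂ ↥(A.map ι₁) ∧
      ∀ A' : Submodule ℂ (Fin m → ℂ), A' ≤ A.map ι₁ → A' ≠ ⊥ →
        finrank ℂ ↥(⨆ f : σ →₀ ℕ, A'.map (Matrix.toLin' (N.map (coeff f)))) ≤ finrank ℂ A' → A' = A.map ι₁ := by
    intro A hA
    obtain ⟨hA0, hAbal, hAmin⟩ := hT₁ A hA
    refine ⟨fun h0 => hA0 ?_, by rw [hW₁, hfin₁, hfin₁]; exact hAbal, fun A' hA'le hA'0 hA'bal => ?_⟩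
    · rw [← Submodule.comap_map_eq_of_injective hι₁inj A, h0, Submodule.comap_bot, LinearMap.ker_eq_bot.2 hι₁inj]
    · have hA'eq : (A'.comap ι₁).map ι₁ = A' :=
        Submodule.map_comap_eq_of_le (hA'le.trans LinearMap.map_le_range)
      have h1 : A'.comap ι₁ ≤ A := by
        rw [← Submodule.comap_map_eq_of_injective hι₁inj A]; exact Submodule.comap_mono hA'le
      have h2 : A'.comap ι₁ ≠ ⊥ := fun h0 => hA'0 (by rw [← hA'eq, h0, Submodule.map_bot])
      have h3 : finrank ℂ ↥(⨆ f : σ →₀ ℕ, (A'.comap ι₁).map (Matrix.toLin' (N₁.map (coeff f)))) ≤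
          finrank ℂ ↥(A'.comap ι₁) := by
        rw [← hfin₁, ← hW₁, hA'eq, ← hfin₁ (A'.comap ι₁), hA'eq]; exact hA'bal
      rw [← hA'eq, hAmin _ h1 h2 h3]
  have hat₂ : ∀ A ∈ T₂, (A.map ι₂) ≠ ⊥ ∧
      finrank ℂ ↥(⨆ f : σ →₀ ℕ, (A.map ι₂).map (Matrix.toLin' (N.map (coeff f)))) ≤ finrank ℂ ↥(A.map ι₂) ∧
      ∀ A' : Submodule ℂ (Fin m → ℂ), A' ≤ A.map ι₂ → A' ≠ ⊥ →
        finrank ℂ ↥(⨆ f : σ →₀ ℕ, A'.map (Matrix.toLin' (N.map (coeff f)))) ≤ finrank ℂ A' → A' = A.map ι₂ := by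
    intro A hA
    obtain ⟨hA0, hAbal, hAmin⟩ := hT₂ A hA
    refine ⟨fun h0 => hA0 ?_, by rw [hW₂, hfin₂, hfin₂]; exact hAbal, fun A' hA'le hA'0 hA'bal => ?_⟩
    · rw [← Submodule.comap_map_eq_of_injective hι₂inj A, h0, Submodule.comap_bot, LinearMap.ker_eq_bot.2 hι₂inj]
    · have hA'eq : (A'.comap ι₂).map ι₂ = A' :=
        Submodule.map_comap_eq_of_le (hA'le.trans LinearMap.map_le_range)
      have h1 : A'.comap ι₂ ≤ A := by
        rw [← Submodule.comap_map_eq_of_injective hι₂inj A]; exact Submodule.comap_mono hA'le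
      have h2 : A'.comap ι₂ ≠ ⊥ := fun h0 => hA'0 (by rw [← hA'eq, h0, Submodule.map_bot])
      have h3 : finrank ℂ ↥(⨆ f : σ →₀ ℕ, (A'.comap ι₂).map (Matrix.toLin' (N₂.map (coeff f)))) ≤
          finrank ℂ ↥(A'.comap ι₂) := by
        rw [← hfin₂, ← hW₂, hA'eq, ← hfin₂ (A'.comap ι₂), hA'eq]; exact hA'bal
      rw [← hA'eq, hAmin _ h1 h2 h3]
  refine ⟨T₁.image (Submodule.map ι₁) ∪ T₂.image (Submodule.map ι₂), fun A hA => ?_, ?_⟩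
  · rcases Finset.mem_union.1 hA with h | h
    · obtain ⟨A₁, hA₁, rfl⟩ := Finset.mem_image.1 h
      exact hat₁ A₁ hA₁
    · obtain ⟨A₂, hA₂, rfl⟩ := Finset.mem_image.1 h
      exact hat₂ A₂ hA₂
  · -- the embedded tops span
    rw [Finset.sup_union, Finset.sup_image, Finset.sup_image]
    have h1 : T₁.sup (id ∘ Submodule.map ι₁) = (T₁.sup id).map ι₁ := by
      rw [Finset.apply_sup_eq_sup_comp (Submodule.map ι₁) (fun x y => Submodule.map_sup _ _ _) (Submodule.map_bot _)]
      rfl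
    have h2 : T₂.sup (id ∘ Submodule.map ι₂) = (T₂.sup id).map ι₂ := by
      rw [Finset.apply_sup_eq_sup_comp (Submodule.map ι₂) (fun x y => Submodule.map_sup _ _ _) (Submodule.map_bot _)]
      rfl
    rw [h1, h2, hT₁top, hT₂top, Submodule.map_top, Submodule.map_top]
    refine top_le_iff.1 fun u _ => ?_
    have hu : u = ι₁ (ρ₁ u) + ι₂ (ρ₂ u) := by
      ext k
      obtain ⟨x, rfl⟩ := e.surjective k
      rcases x with i | i
      · rw [Pi.add_apply, hι₁, hι₂', add_zero]; rfl
      · rw [Pi.add_apply, hι₁', hι₂, zero_add]; rfl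
    rw [hu]
    exact Submodule.add_mem_sup (LinearMap.mem_range_self _ _) (LinearMap.mem_range_self _ _)

end Atoms

end Summit.ValiantsHypothesis.ValiantsHypothesis.Theorems.FreeSubtorusOrbitDimensionBound.SquareCovering.StableReduction
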